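import Summits.QuantumFields.YangMills.Theorems.BalabanUVNodesN16KingModelTwoRunHolderDerivSup

/-!
# Route «BalabanUVNodes» (K3⁶ `SpineGivenEndpointR13SepCoPR`), DAG node N16 = NE3 — THE KING-MODEL RUNG OF NE3: THE COMPLETE PRINTED
# CURRENCY LIST OF THE TWO-RUN DISCREPANCY — value, first difference, Hölder modulus of the value, AND the Hölder modulus of the first
# difference — in King's `A = 0` model, ONE level- and volume-free constant (King (3.71) lines 1–4 + Thm 3.3, BY NAME)

Cell `pub-ymgap`, seat `pub-ymgap-dag-n16-c` (R134 acceleration seat, strategy s1; HUMAN RULING D-0062; chair R424 venue), generation 10.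
`--kind proof --supports stmt-QuantumFields-20509 --as helper` (K3⁶, dag-lead WORDS-142).  `bears_on: R4∕N16 · row «R2^ϱ, the unprinted core»`.

WHY THIS FILE.  Node N16's statement of record `NE3EnergyWeightedCovShape.NE3EnergyRateWCov` (β = 1) and this seat's Hölder re-typings
`N16HolderDefs.CovRootHolder β` ∕ `N16HolderMSDefs.CovRootHolderMS β` ask, inside ONE `∃ (u, Z)` per level, for the [B8] (1.36) ∕ [B11] (8)–(10)
currency list of the two-run discrepancy direction `Z`: value `‖Z‖ ≤ B·ξ·θ^k`, first covariant differences (Lip₁ᶜ) `≤ Λ₁·ξ²·θ^k`, and the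
Hölder-`β` modulus of the first covariant differences ((1.36)₃; (Lip₂′ᶜ) at `β = 1`).  Generation 8's `N16KingModelPattern.twoRun_threeCurrencies_
le_sup` (file 57) typed, with ONE constant, the value (g7), the first difference (g8) and the Hölder modulus OF THE VALUE (g8) for King's
block-averaged two-run discrepancy `D = φ_K^ψ − Q_nφ_{K+n}^ψ`; generation 10's files 60–62 added King's (3.71) LINE 4 — the Hölder modulus
OF THE FIRST DIFFERENCE (`N16KingModelHolderDerivSup.twoRunHolderDeriv_minimiser_blockMean_le_sup`).  THIS file is the one-constant union:
ALL FOUR printed lines of King's Prop. 3.8 for `D`, i.e. the complete scalar template of the currency list the node's root reads — in particular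
of the THIRD conjunct in its printed Hölder form `β = α < 1` (R-β ∕ R-β″; at `β = 1` King prints no rate).

WHAT THIS FILE PROVES (kernel; ONE theorem, 0 `def`, 0 sorry):
★★ `twoRun_fourCurrencies_le_sup` — for `d ≥ 1`, odd `L ≥ 2`, `a, m² > 0`, `0 < α`, `0 < γ`, `α + γ < 1` there is `C ≥ 0` (a function of
`d, L, a, m², γ, α` only) such that for EVERY volume `P = (d, L, m, K)` of the `B1∕B4` tower with `K ≥ 1`, every `n ≥ 1`, every datum `|ψ| ≤ S`,
every coarse point `x`, direction `μ` and coarse vector `v`, with `θ = L^{−γ∕2} < 1`, `ρ = holdist L^K M x (x + v)`, `D = φ_K^ψ − Q_nφ_{K+n}^ψ`: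
`|D(x)| ≤ C·θ^K·S`, `|D(x + e_μ) − D(x)| ≤ C·(L^K)⁻¹·θ^K·S`, `|D(x) − D(x + v)| ≤ C·ρ^α·θ^K·S`, AND
`|(D(x + e_μ) − D(x)) − (D(x + v + e_μ) − D(x + v))| ≤ C·(L^K)⁻¹·ρ^α·θ^K·S` — the mixed second difference is one lattice spacing times the
Hölder weight times the rate: (1.36)₃'s pattern `‖∇Z(x) − ∇Z(y)‖ ≤ B_h·ξ²·|x − y|^β·θ^k` (one `ξ` per derivative in unit coordinates, `Ad = id`).

HONEST FRAMING.  A MODEL LAYER ([King1986] printed AND proved; kernel re-proof BY NAME).  NOTHING of [Balaban1985RegularSpaces] ∕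
[Balaban1985Variational] is proved or discharged; N16 ∕ NE3 is NOT discharged (in-edges N05 — [B8] Thm 4 ∕ Prop 3 at the pinned all-torus
members — and N07 — [B11] Thm 1 (8)+(10) — remain hypotheses of the chain of record); COUNT UNMOVED; count-neutral; one finite torus at a
time — NOT ℝ⁴, NOT infinite volume, NOT OS, NOT a mass gap, NOT Clay.

Sources: C. King, *The U(1) Higgs model. I. The continuum limit*, Commun. Math. Phys. **102** (1986) 649–677 [King1986], Prop. 3.8
(3.71) p. 664 (lines 1–4), (3.62) p. 663, Thm 3.3 (3.7)–(3.8) p. 658, p. 674; T. Bałaban, *Regularity and decay of lattice Green's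
functions*, Commun. Math. Phys. **89** (1983) 571–597 [Balaban1983RegularityDecay], Thm (1.10) p. 573.
-/

set_option autoImplicit false

noncomputable section

open Real Finset
open scoped BigOperators

namespace Summit.QuantumFields.YangMills.BalabanUVNodes.N16KingModelFourCurrencies

open Literature.MathematicalPhysics.QuantumFieldTheory.Balaban1983to89 (Params)
open Literature.MathematicalPhysics.QuantumFieldTheory.Balaban1983to89.B5Prop11Plancherel (Tor fine unitVec)
open Literature.MathematicalPhysics.QuantumFieldTheory.Balaban1983to89.B4Sect5Proof (latticeConst latticeConst_nonneg)
open Literature.MathematicalPhysics.QuantumFieldTheory.King1986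
  (aK fprop38RateConst fprop38PosConst)
open Literature.MathematicalPhysics.QuantumFieldTheory.King1986.Torus (minimiser tdistT tdistT_nonneg holdist)
open Summit.QuantumFields.YangMills.BalabanUVNodes.N18KingModel (kingTheta_pos)
open Summit.QuantumFields.YangMills.BalabanUVNodes.N16KingModelDeriv (abs_le_of_holder_bound)
open Summit.QuantumFields.YangMills.BalabanUVNodes.N16KingModelPattern (eq_zero_of_tdistT_add_eq_zero twoRun_threeCurrencies_le_sup)
open Summit.QuantumFields.YangMills.BalabanUVNodes.N16KingModelHolderDerivSup (twoRunHolderDeriv_minimiser_blockMean_le_sup)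

variable {d : ℕ}

/-- ★★ **ALL FOUR PRINTED CURRENCIES OF THE TWO-RUN DISCREPANCY IN KING's MODEL, ONE LEVEL- AND VOLUME-FREE CONSTANT** (statement in the
module docstring): generation 8's three (`N16KingModelPattern.twoRun_threeCurrencies_le_sup`) and generation 10's derivative-Hölder line
(`N16KingModelHolderDerivSup.twoRunHolderDeriv_minimiser_blockMean_le_sup`, the Hölder weight multiplied out and one factor `η = (L^K)⁻¹` taken
off the unit-coordinate derivative), `C` = the max of the two constants. [cite: King1986, Prop. 3.8 (3.71) p.664 (lines 1–4), Thm 3.3 (3.7)–(3.8) p.658, p.674] -/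
theorem twoRun_fourCurrencies_le_sup (dd L : ℕ) (hd : 1 ≤ dd) (hLodd : Odd L) (hL : 2 ≤ L) {a m2 : ℝ} (ha : 0 < a)
    (hm : 0 < m2) {α γ : ℝ} (hα : 0 < α) (hγ : 0 < γ) (hαγ : α + γ < 1) :
    ∃ C : ℝ, 0 ≤ C ∧
      ∀ (P : Params) (_hPd : P.d = dd) (_hPL : P.L = L) (_hK : 1 ≤ P.K) [NeZero P.L]
      (n : ℕ) (_hn : 1 ≤ n) (M : Fin P.d → ℕ) [∀ μ, NeZero (M μ)] (_hMK : ∀ μ, M μ = P.sitesPerDir P.K)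
      (ψ : Tor M → ℝ) (S : ℝ) (_hS : ∀ b, |ψ b| ≤ S) (xt : Tor (fine (P.L ^ P.K) M)) (μ : Fin P.d)
      (v : Tor (fine (P.L ^ P.K) M)),
      |minimiser (P.L ^ P.K) M (aK a P.L P.K) (((P.L ^ P.K : ℕ) : ℝ) ^ 2) m2 ψ xt
          - (((Finset.univ.filter fun x' : Tor (fine (P.L ^ n * P.L ^ P.K) M) =>
                ∀ ν, (xt ν).val = (x' ν).val / P.L ^ n).card : ℝ))⁻¹ *
            ∑ x' ∈ (Finset.univ.filter fun x' : Tor (fine (P.L ^ n * P.L ^ P.K) M) =>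
                ∀ ν, (xt ν).val = (x' ν).val / P.L ^ n),
              minimiser (P.L ^ n * P.L ^ P.K) M (aK a P.L (P.K + n)) (((P.L ^ n * P.L ^ P.K : ℕ) : ℝ) ^ 2) m2 ψ x'|
        ≤ C * ((L : ℝ) ^ (-(γ / 2))) ^ P.K * S ∧
      |(minimiser (P.L ^ P.K) M (aK a P.L P.K) (((P.L ^ P.K : ℕ) : ℝ) ^ 2) m2 ψ (xt + unitVec (fine (P.L ^ P.K) M) μ)
            - (((Finset.univ.filter fun y : Tor (fine (P.L ^ n * P.L ^ P.K) M) =>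
                  ∀ ν, ((xt + unitVec (fine (P.L ^ P.K) M) μ) ν).val = (y ν).val / P.L ^ n).card : ℝ))⁻¹ *
              ∑ y ∈ (Finset.univ.filter fun y : Tor (fine (P.L ^ n * P.L ^ P.K) M) =>
                  ∀ ν, ((xt + unitVec (fine (P.L ^ P.K) M) μ) ν).val = (y ν).val / P.L ^ n),
                minimiser (P.L ^ n * P.L ^ P.K) M (aK a P.L (P.K + n)) (((P.L ^ n * P.L ^ P.K : ℕ) : ℝ) ^ 2) m2 ψ y)
          - (minimiser (P.L ^ P.K) M (aK a P.L P.K) (((P.L ^ P.K : ℕ) : ℝ) ^ 2) m2 ψ xt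
            - (((Finset.univ.filter fun x' : Tor (fine (P.L ^ n * P.L ^ P.K) M) =>
                  ∀ ν, (xt ν).val = (x' ν).val / P.L ^ n).card : ℝ))⁻¹ *
              ∑ x' ∈ (Finset.univ.filter fun x' : Tor (fine (P.L ^ n * P.L ^ P.K) M) =>
                  ∀ ν, (xt ν).val = (x' ν).val / P.L ^ n),
                minimiser (P.L ^ n * P.L ^ P.K) M (aK a P.L (P.K + n)) (((P.L ^ n * P.L ^ P.K : ℕ) : ℝ) ^ 2) m2 ψ x')|
        ≤ C * (((L : ℝ) ^ P.K))⁻¹ * ((L : ℝ) ^ (-(γ / 2))) ^ P.K * S ∧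
      |(minimiser (P.L ^ P.K) M (aK a P.L P.K) (((P.L ^ P.K : ℕ) : ℝ) ^ 2) m2 ψ xt
            - (((Finset.univ.filter fun x' : Tor (fine (P.L ^ n * P.L ^ P.K) M) =>
                  ∀ ν, (xt ν).val = (x' ν).val / P.L ^ n).card : ℝ))⁻¹ *
              ∑ x' ∈ (Finset.univ.filter fun x' : Tor (fine (P.L ^ n * P.L ^ P.K) M) =>
                  ∀ ν, (xt ν).val = (x' ν).val / P.L ^ n),
                minimiser (P.L ^ n * P.L ^ P.K) M (aK a P.L (P.K + n)) (((P.L ^ n * P.L ^ P.K : ℕ) : ℝ) ^ 2) m2 ψ x')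
          - (minimiser (P.L ^ P.K) M (aK a P.L P.K) (((P.L ^ P.K : ℕ) : ℝ) ^ 2) m2 ψ (xt + v)
            - (((Finset.univ.filter fun y : Tor (fine (P.L ^ n * P.L ^ P.K) M) =>
                  ∀ ν, ((xt + v) ν).val = (y ν).val / P.L ^ n).card : ℝ))⁻¹ *
              ∑ y ∈ (Finset.univ.filter fun y : Tor (fine (P.L ^ n * P.L ^ P.K) M) =>
                  ∀ ν, ((xt + v) ν).val = (y ν).val / P.L ^ n),
                minimiser (P.L ^ n * P.L ^ P.K) M (aK a P.L (P.K + n)) (((P.L ^ n * P.L ^ P.K : ℕ) : ℝ) ^ 2) m2 ψ y)|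
        ≤ C * (holdist (P.L ^ P.K) M xt (xt + v)) ^ α * ((L : ℝ) ^ (-(γ / 2))) ^ P.K * S ∧
      |((minimiser (P.L ^ P.K) M (aK a P.L P.K) (((P.L ^ P.K : ℕ) : ℝ) ^ 2) m2 ψ (xt + unitVec (fine (P.L ^ P.K) M) μ)
            - (((Finset.univ.filter fun y : Tor (fine (P.L ^ n * P.L ^ P.K) M) =>
                  ∀ ν, ((xt + unitVec (fine (P.L ^ P.K) M) μ) ν).val = (y ν).val / P.L ^ n).card : ℝ))⁻¹ *
              ∑ y ∈ (Finset.univ.filter fun y : Tor (fine (P.L ^ n * P.L ^ P.K) M) =>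
                  ∀ ν, ((xt + unitVec (fine (P.L ^ P.K) M) μ) ν).val = (y ν).val / P.L ^ n),
                minimiser (P.L ^ n * P.L ^ P.K) M (aK a P.L (P.K + n)) (((P.L ^ n * P.L ^ P.K : ℕ) : ℝ) ^ 2) m2 ψ y)
          - (minimiser (P.L ^ P.K) M (aK a P.L P.K) (((P.L ^ P.K : ℕ) : ℝ) ^ 2) m2 ψ (xt)
            - (((Finset.univ.filter fun y : Tor (fine (P.L ^ n * P.L ^ P.K) M) =>
                  ∀ ν, ((xt) ν).val = (y ν).val / P.L ^ n).card : ℝ))⁻¹ *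
              ∑ y ∈ (Finset.univ.filter fun y : Tor (fine (P.L ^ n * P.L ^ P.K) M) =>
                  ∀ ν, ((xt) ν).val = (y ν).val / P.L ^ n),
                minimiser (P.L ^ n * P.L ^ P.K) M (aK a P.L (P.K + n)) (((P.L ^ n * P.L ^ P.K : ℕ) : ℝ) ^ 2) m2 ψ y))
        - ((minimiser (P.L ^ P.K) M (aK a P.L P.K) (((P.L ^ P.K : ℕ) : ℝ) ^ 2) m2 ψ (xt + v + unitVec (fine (P.L ^ P.K) M) μ)
            - (((Finset.univ.filter fun y : Tor (fine (P.L ^ n * P.L ^ P.K) M) =>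
                  ∀ ν, ((xt + v + unitVec (fine (P.L ^ P.K) M) μ) ν).val = (y ν).val / P.L ^ n).card : ℝ))⁻¹ *
              ∑ y ∈ (Finset.univ.filter fun y : Tor (fine (P.L ^ n * P.L ^ P.K) M) =>
                  ∀ ν, ((xt + v + unitVec (fine (P.L ^ P.K) M) μ) ν).val = (y ν).val / P.L ^ n),
                minimiser (P.L ^ n * P.L ^ P.K) M (aK a P.L (P.K + n)) (((P.L ^ n * P.L ^ P.K : ℕ) : ℝ) ^ 2) m2 ψ y)
          - (minimiser (P.L ^ P.K) M (aK a P.L P.K) (((P.L ^ P.K : ℕ) : ℝ) ^ 2) m2 ψ (xt + v)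
            - (((Finset.univ.filter fun y : Tor (fine (P.L ^ n * P.L ^ P.K) M) =>
                  ∀ ν, ((xt + v) ν).val = (y ν).val / P.L ^ n).card : ℝ))⁻¹ *
              ∑ y ∈ (Finset.univ.filter fun y : Tor (fine (P.L ^ n * P.L ^ P.K) M) =>
                  ∀ ν, ((xt + v) ν).val = (y ν).val / P.L ^ n),
                minimiser (P.L ^ n * P.L ^ P.K) M (aK a P.L (P.K + n)) (((P.L ^ n * P.L ^ P.K : ℕ) : ℝ) ^ 2) m2 ψ y))|
        ≤ C * (((L : ℝ) ^ P.K))⁻¹ * (holdist (P.L ^ P.K) M xt (xt + v)) ^ α * ((L : ℝ) ^ (-(γ / 2))) ^ P.K * S := by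
  obtain ⟨C₃, hC₃, H3⟩ := twoRun_threeCurrencies_le_sup dd L hd hLodd hL ha hm hα hγ hαγ.le
  obtain ⟨δ, c, δ₁, c₁, hδ, hc, hδ₁, hc₁, H4⟩ := twoRunHolderDeriv_minimiser_blockMean_le_sup dd L hd hLodd hL ha hm hα hγ hαγ
  set C₄ : ℝ := 4 * Real.sqrt (2 * c *
        (fprop38RateConst a a (a * (2 * ((a * (1 - ((L : ℝ) ^ 2)⁻¹))⁻¹ + π ^ 2 / 48 + 1 / 3))) ((π ^ 2 / 4) ^ dd) dd γ
            (α + 1) (2 * (dd : ℝ) ^ α) (2 * (dd : ℝ) ^ α * 2 ^ (1 - γ))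
          + fprop38PosConst a ((π ^ 2 / 4) ^ dd) dd γ (α + 1) (2 * (dd : ℝ) ^ α) (6 * (dd : ℝ) ^ (α + γ))))
      * latticeConst dd (δ / 2)
    + 4 * c₁ * latticeConst dd δ₁ with hC₄
  have hC₄0 : 0 ≤ C₄ :=
    add_nonneg (mul_nonneg (mul_nonneg (by norm_num) (Real.sqrt_nonneg _)) (latticeConst_nonneg dd (by positivity)))
      (mul_nonneg (mul_nonneg (by norm_num) hc₁.le) (latticeConst_nonneg dd hδ₁.le))
  refine ⟨max C₃ C₄, le_max_of_le_left hC₃, ?_⟩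
  intro P hPd hPL hK _ n hn M _ hMK ψ S hS xt μ v
  obtain ⟨hV, hD, hHo⟩ := H3 P hPd hPL hK n hn M hMK ψ S hS xt μ v
  have h4 := H4 P hPd hPL hK n hn M hMK ψ S hS xt v μ
  subst hPd hPL
  have hS0 : 0 ≤ S := (abs_nonneg _).trans (hS 0)
  have hθ : 0 ≤ ((P.L : ℝ) ^ (-(γ / 2))) ^ P.K := pow_nonneg (kingTheta_pos (by omega) (γ / 2)).le _
  have hNr : (0 : ℝ) < (P.L : ℝ) ^ P.K := by positivity
  have hNinv : 0 ≤ (((P.L : ℝ) ^ P.K))⁻¹ := inv_nonneg.2 hNr.le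
  have hρ0 : 0 ≤ holdist (P.L ^ P.K) M xt (xt + v) := by
    unfold holdist; exact div_nonneg (tdistT_nonneg _ _ _) (Nat.cast_nonneg _)
  have hρα : 0 ≤ (holdist (P.L ^ P.K) M xt (xt + v)) ^ α := Real.rpow_nonneg hρ0 _
  refine ⟨hV.trans (mul_le_mul_of_nonneg_right (mul_le_mul_of_nonneg_right (le_max_left _ _) hθ) hS0),
    hD.trans (mul_le_mul_of_nonneg_right (mul_le_mul_of_nonneg_right
      (mul_le_mul_of_nonneg_right (le_max_left _ _) hNinv) hθ) hS0),
    hHo.trans (mul_le_mul_of_nonneg_right (mul_le_mul_of_nonneg_right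
      (mul_le_mul_of_nonneg_right (le_max_left _ _) hρα) hθ) hS0), ?_⟩
  -- the fourth currency: take the Hölder weight and one factor `L^K` off the derivative-Hölder bound
  have hcast : (((P.L ^ P.K : ℕ) : ℝ)) = (P.L : ℝ) ^ P.K := by push_cast; ring
  rcases hρ0.eq_or_lt with hρ | hρ
  · -- zero distance: `v = 0`, the mixed difference vanishes
    have htd : tdistT (fine (P.L ^ P.K) M) xt (xt + v) = 0 := by
      have hN : (0 : ℝ) < ((P.L ^ P.K : ℕ) : ℝ) := by exact_mod_cast pow_pos (show 0 < P.L by omega) P.K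
      have h := hρ.symm
      unfold holdist at h
      rw [div_eq_zero_iff] at h
      exact h.resolve_right hN.ne'
    have hv : v = 0 := eq_zero_of_tdistT_add_eq_zero xt v htd
    subst hv
    rw [add_zero] at hρα
    rw [add_zero, sub_self, abs_zero]
    exact mul_nonneg (mul_nonneg (mul_nonneg (mul_nonneg (le_trans hC₃ (le_max_left _ _)) hNinv) hρα) hθ) hS0
  · -- positive distance
    have hNc : (0 : ℝ) < ((P.L ^ P.K : ℕ) : ℝ) := by exact_mod_cast pow_pos (show 0 < P.L by omega) P.K
    have h2 := abs_le_of_holder_bound hρ h4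
    -- `h2 : |L^K·d₁ − L^K·d₂| ≤ C₄·θ^K·S·ρ^α`; divide by `L^K`
    rw [← mul_sub, abs_mul, abs_of_pos hNc, ← le_div_iff₀' hNc] at h2
    refine h2.trans ?_
    rw [hcast, div_eq_inv_mul]
    have hY : 0 ≤ (((P.L : ℝ) ^ P.K))⁻¹ * (holdist (P.L ^ P.K) M xt (xt + v)) ^ α * ((P.L : ℝ) ^ (-(γ / 2))) ^ P.K * S :=
      mul_nonneg (mul_nonneg (mul_nonneg hNinv hρα) hθ) hS0
    calc (((P.L : ℝ) ^ P.K))⁻¹ * (C₄ * ((P.L : ℝ) ^ (-(γ / 2))) ^ P.K * S * (holdist (P.L ^ P.K) M xt (xt + v)) ^ α)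
        = C₄ * ((((P.L : ℝ) ^ P.K))⁻¹ * (holdist (P.L ^ P.K) M xt (xt + v)) ^ α * ((P.L : ℝ) ^ (-(γ / 2))) ^ P.K * S) := by
          ring
      _ ≤ max C₃ C₄ * ((((P.L : ℝ) ^ P.K))⁻¹ * (holdist (P.L ^ P.K) M xt (xt + v)) ^ α * ((P.L : ℝ) ^ (-(γ / 2))) ^ P.K * S) :=
          mul_le_mul_of_nonneg_right (le_max_right _ _) hY
      _ = _ := by ring

end Summit.QuantumFields.YangMills.BalabanUVNodes.N16KingModelFourCurrencies

end
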